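import Literature.NumberTheory.LFunctions.CentralOrderForcedByStructure
import Literature.NumberTheory.LFunctions.DedekindZetaFunctionalEquationProofs
import Literature.NumberTheory.LFunctions.DedekindZetaFiniteOrderProofs
import Literature.NumberTheory.LFunctions.DedekindZetaERHProofs
import Literature.NumberTheory.LFunctions.DedekindZetaNonvanishing
import Literature.NumberTheory.LFunctions.ClassGroupLFunctionLogDerivLeft
import HarnessLib

/-!
# The Dedekind zeta function vanishes to even order at the central point `s = 1/2`

Topic `NumberTheory/LFunctions`. For every number field `K`, Hecke's functional equation
`Λ_K(1 - s) = Λ_K(s)` (Neukirch, *Algebraic Number Theory*, VII (5.10) Corollary; in the tree the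
PROVED `completedDedekindZeta_one_sub_holds`) has root number `+1`, so by the parity mechanism
(`CentralOrder.sign_eq_neg_one_pow`: order `n` at the centre forces `w = (-1)ⁿ`) the order of
vanishing of `Λ_K`, hence of `ζ_K`, at the centre `s = 1/2` is EVEN; in particular a central zero
`ζ_K(1/2) = 0` (Armitage 1972, Fröhlich 1972: quaternion fields whose symplectic character has
Artin root number `-1`) is at least a double zero. Everything here is PROVED, unconditionally, from
tree theorems: the functional equation (`completedDedekindZeta_one_sub_holds`), holomorphy of
`ζ_K` off `s = 1` (`differentiableOn_dedekindZetaCont_holds`), holomorphy and non-vanishing of the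
gamma factor `γ_K(s) = |d_K|^{s/2} Γ_ℝ(s)^{r₁} Γ_ℂ(s)^{r₂}` off the non-positive integers
(`differentiableAt_dedekindGammaFactor`, `dedekindGammaFactor_ne_zero`), and `ζ_K(2) ≠ 0`
(`dedekindZetaCont_ne_zero_of_one_le_re_holds`) with the identity theorem (the order at `1/2` is
finite).

* `CentralOrder.sign_eq_neg_one_pow_of_eventually` — the parity mechanism with the functional
  equation assumed only near the centre (Hecke's is stated off the integers);
* `analyticAt_completedDedekindZeta_half`, `completedDedekindZeta_one_sub_eventually_half`;
* `even_analyticOrderNatAt_completedDedekindZeta_half` — `ord_{s=1/2} Λ_K` is even;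
* `analyticOrderAt_dedekindZetaCont_half_ne_top`, `even_analyticOrderNatAt_dedekindZetaCont_half` —
  `ord_{s=1/2} ζ_K` is finite and even; `two_le_analyticOrderNatAt_dedekindZetaCont_half_of_eq_zero`
  — `ζ_K(1/2) = 0 ⇒ ord_{s=1/2} ζ_K ≥ 2`.

## References

* [NeukirchANT1999] J. Neukirch, *Algebraic Number Theory*, VII (5.10) Corollary (functional
  equation `Λ_K(1-s) = Λ_K(s)`).
* [Frohlich1972] A. Fröhlich, *Artin-root numbers and normal integral bases for quaternion fields*,
  Invent. Math. 17 (1972) (central zeros of `ζ_K` from `W(ρ) = -1`).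
-/

noncomputable section

open Filter Set Complex

open scoped Topology

namespace Literature.NumberTheory.LFunctions

/-! ### The parity mechanism with an eventual functional equation -/

namespace CentralOrder

/-- **Parity constraint, functional equation near the centre only.** As
`CentralOrder.sign_eq_neg_one_pow`, but assuming `Λ(c - s) = w Λ(s)` only for `s` in a neighbourhood
of the centre `a` (`a + a = c`) — the form in which Hecke's functional equation, stated off the
integers, is available near `s = 1/2`. [cite: NeukirchANT1999, VII (5.10) Corollary] -/
theorem sign_eq_neg_one_pow_of_eventually {Λ : ℂ → ℂ} {w c a : ℂ} (hΛ : AnalyticAt ℂ Λ a)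
    (hFE : ∀ᶠ s in 𝓝 a, Λ (c - s) = w * Λ s) (ha : a + a = c) {n : ℕ}
    (hn : analyticOrderAt Λ a = n) : w = (-1) ^ n := by
  obtain ⟨g, hg, hg0, hev⟩ := hΛ.analyticOrderAt_eq_natCast.mp hn
  have hca : c - a = a := by rw [← ha]; ring
  have hrefl : Tendsto (fun z : ℂ => c - z) (𝓝 a) (𝓝 a) := by
    have hc : Continuous (fun z : ℂ => c - z) := by fun_prop
    simpa only [hca] using hc.tendsto a
  have hev' : ∀ᶠ z in 𝓝 a, Λ (c - z) = ((c - z) - a) ^ n • g (c - z) := hrefl.eventually hev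
  have key : ∀ᶠ z in 𝓝[≠] a, (-1) ^ n * g (c - z) = w * g z := by
    have hall : ∀ᶠ z in 𝓝[≠] a, Λ z = (z - a) ^ n • g z ∧
        Λ (c - z) = ((c - z) - a) ^ n • g (c - z) ∧ Λ (c - z) = w * Λ z :=
      ((hev.and hev').and hFE).filter_mono nhdsWithin_le_nhds |>.mono fun z h ↦
        ⟨h.1.1, h.1.2, h.2⟩
    have hne : ∀ᶠ z in 𝓝[≠] a, z ≠ a := eventually_mem_nhdsWithin
    filter_upwards [hall, hne] with z ⟨h1, h1', hFEz⟩ hz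
    rw [h1', h1] at hFEz
    simp only [smul_eq_mul] at hFEz
    have hz' : (z - a) ^ n ≠ 0 := pow_ne_zero _ (sub_ne_zero.mpr hz)
    have e : (c - z - a : ℂ) = (-1) * (z - a) := by rw [← ha]; ring
    rw [e, mul_pow] at hFEz
    apply mul_left_cancel₀ hz'
    linear_combination hFEz
  have hlim1 : Tendsto (fun z => (-1 : ℂ) ^ n * g (c - z)) (𝓝[≠] a) (𝓝 ((-1) ^ n * g a)) := by
    have : Tendsto (fun z => g (c - z)) (𝓝 a) (𝓝 (g a)) :=
      hg.continuousAt.tendsto.comp hrefl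
    exact (this.const_mul _).mono_left nhdsWithin_le_nhds
  have hlim2 : Tendsto (fun z => w * g z) (𝓝[≠] a) (𝓝 (w * g a)) :=
    (hg.continuousAt.tendsto.const_mul w).mono_left nhdsWithin_le_nhds
  have heq : (-1 : ℂ) ^ n * g a = w * g a := tendsto_nhds_unique (hlim1.congr' key) hlim2
  exact (mul_right_cancel₀ hg0 heq).symm

/-- **Sign `+1` near the centre forces an even order** (`ℕ`-valued order; trivially even, namely
`0`, if `Λ` vanishes identically near `a`). [cite: NeukirchANT1999, VII (5.10) Corollary] -/
theorem even_analyticOrderNatAt_of_eventually {Λ : ℂ → ℂ} {c a : ℂ} (hΛ : AnalyticAt ℂ Λ a)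
    (hFE : ∀ᶠ s in 𝓝 a, Λ (c - s) = 1 * Λ s) (ha : a + a = c) :
    Even (analyticOrderNatAt Λ a) := by
  rcases eq_or_ne (analyticOrderAt Λ a) ⊤ with htop | htop
  · simp [analyticOrderNatAt, htop]
  · have hn : analyticOrderAt Λ a = (analyticOrderNatAt Λ a : ℕ) :=
      (Nat.cast_analyticOrderNatAt htop).symm
    have hw := sign_eq_neg_one_pow_of_eventually hΛ hFE ha hn
    by_contra hodd
    rw [Nat.not_even_iff_odd] at hodd
    rw [hodd.neg_one_pow] at hw
    norm_num at hw

end CentralOrder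

/-! ### The Dedekind zeta function at `s = 1/2` -/

section DedekindZeta

variable (K : Type*) [Field K] [NumberField K]

/-- The open vertical strip `0 < Re s < 1`: a neighbourhood of `1/2` free of integers and of the
pole `s = 1`. [folklore] -/
private theorem strip_mem_nhds_half :
    {s : ℂ | 0 < s.re ∧ s.re < 1} ∈ 𝓝 ((1 : ℂ) / 2) := by
  have hopen : IsOpen {s : ℂ | 0 < s.re ∧ s.re < 1} :=
    (isOpen_lt continuous_const Complex.continuous_re).inter
      (isOpen_lt Complex.continuous_re continuous_const)
  refine hopen.mem_nhds ⟨?_, ?_⟩ <;> norm_num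

/-- No integer lies in the strip `0 < Re s < 1`. [folklore] -/
private theorem ne_intCast_of_mem_strip {s : ℂ} (hs : 0 < s.re ∧ s.re < 1) (n : ℤ) :
    s ≠ n := by
  rintro rfl
  simp only [Complex.intCast_re] at hs
  have h1 : (0 : ℤ) < n := by exact_mod_cast hs.1
  have h2 : n < (1 : ℤ) := by exact_mod_cast hs.2
  omega

/-- **`Λ_K` is analytic at `s = 1/2`**: on the strip `0 < Re s < 1` the continued zeta function is
holomorphic (`differentiableOn_dedekindZetaCont_holds`, off the pole `1`) and so is the gamma factor
(`differentiableAt_dedekindGammaFactor`, off `0, -1, -2, …`). [cite: NeukirchANT1999, VII (5.10) Corollary] -/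
theorem analyticAt_completedDedekindZeta_half :
    AnalyticAt ℂ (completedDedekindZeta K) ((1 : ℂ) / 2) := by
  have hopen : IsOpen {s : ℂ | 0 < s.re ∧ s.re < 1} :=
    (isOpen_lt continuous_const Complex.continuous_re).inter
      (isOpen_lt Complex.continuous_re continuous_const)
  have hdiff : DifferentiableOn ℂ (completedDedekindZeta K) {s : ℂ | 0 < s.re ∧ s.re < 1} := by
    intro s hs
    have hγ : DifferentiableAt ℂ (dedekindGammaFactor K) s :=
      NumberField.differentiableAt_dedekindGammaFactor fun m h ↦ by
        have := ne_intCast_of_mem_strip hs (-(m : ℤ))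
        push_cast at this
        exact this h
    have hζ : DifferentiableAt ℂ (dedekindZetaCont K) s :=
      (differentiableOn_dedekindZetaCont_holds K).differentiableAt
        (isOpen_compl_singleton.mem_nhds (by
          have := ne_intCast_of_mem_strip hs 1
          push_cast at this
          exact this))
    exact (hγ.mul hζ).differentiableWithinAt
  exact hdiff.analyticAt (hopen.mem_nhds (by refine ⟨?_, ?_⟩ <;> norm_num))

/-- **Hecke's functional equation near the centre**: `Λ_K(1 - s) = Λ_K(s)` for all `s` near `1/2`
(the tree theorem `completedDedekindZeta_one_sub_holds` holds off the integers, and the strip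
`0 < Re s < 1` contains none). [cite: NeukirchANT1999, VII (5.10) Corollary] -/
theorem completedDedekindZeta_one_sub_eventually_half :
    ∀ᶠ s in 𝓝 ((1 : ℂ) / 2),
      completedDedekindZeta K (1 - s) = 1 * completedDedekindZeta K s := by
  filter_upwards [strip_mem_nhds_half] with s hs
  rw [one_mul]
  exact completedDedekindZeta_one_sub_holds (ne_intCast_of_mem_strip hs)

/-- **`ord_{s=1/2} Λ_K(s)` is even** for every number field `K`: root number `+1` in
`Λ_K(1 - s) = Λ_K(s)` and the parity mechanism (`CentralOrder.even_analyticOrderNatAt_of_eventually`,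
centre `1/2 + 1/2 = 1`). [cite: NeukirchANT1999, VII (5.10) Corollary] -/
theorem even_analyticOrderNatAt_completedDedekindZeta_half :
    Even (analyticOrderNatAt (completedDedekindZeta K) ((1 : ℂ) / 2)) :=
  CentralOrder.even_analyticOrderNatAt_of_eventually (analyticAt_completedDedekindZeta_half K)
    (completedDedekindZeta_one_sub_eventually_half K) (by norm_num)

/-- `ζ_K` is analytic at `1/2` (holomorphic off `s = 1`). [cite: NeukirchANT1999, Ch. VII (5.11) (i)] -/
theorem analyticAt_dedekindZetaCont_half : AnalyticAt ℂ (dedekindZetaCont K) ((1 : ℂ) / 2) :=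
  (differentiableOn_dedekindZetaCont_holds K).analyticAt
    (isOpen_compl_singleton.mem_nhds (by norm_num))

/-- **`ord_{s=1/2} ζ_K = ord_{s=1/2} Λ_K`**: the gamma factor `γ_K` is holomorphic and non-zero at
`1/2` (`differentiableAt_dedekindGammaFactor`, `dedekindGammaFactor_ne_zero`), hence of order `0`,
and orders add (`analyticOrderAt_mul`). [cite: NeukirchANT1999, VII (5.10) Corollary] -/
theorem analyticOrderAt_dedekindZetaCont_half_eq :
    analyticOrderAt (dedekindZetaCont K) ((1 : ℂ) / 2) =
      analyticOrderAt (completedDedekindZeta K) ((1 : ℂ) / 2) := by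
  have hhalf : ∀ n : ℤ, ((1 : ℂ) / 2) ≠ n :=
    ne_intCast_of_mem_strip (by refine ⟨?_, ?_⟩ <;> norm_num)
  have hγan : AnalyticAt ℂ (dedekindGammaFactor K) ((1 : ℂ) / 2) := by
    have hopen : IsOpen {s : ℂ | 0 < s.re ∧ s.re < 1} :=
      (isOpen_lt continuous_const Complex.continuous_re).inter
        (isOpen_lt Complex.continuous_re continuous_const)
    refine DifferentiableOn.analyticAt (s := {s : ℂ | 0 < s.re ∧ s.re < 1}) ?_
      (hopen.mem_nhds (by refine ⟨?_, ?_⟩ <;> norm_num))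
    intro s hs
    exact (NumberField.differentiableAt_dedekindGammaFactor fun m h ↦ by
      have := ne_intCast_of_mem_strip hs (-(m : ℤ))
      push_cast at this
      exact this h).differentiableWithinAt
  have hγ0 : analyticOrderAt (dedekindGammaFactor K) ((1 : ℂ) / 2) = 0 :=
    hγan.analyticOrderAt_eq_zero.mpr (NumberField.dedekindGammaFactor_ne_zero hhalf)
  have hmul : completedDedekindZeta K = dedekindGammaFactor K * dedekindZetaCont K := by
    funext s; rfl
  rw [hmul, analyticOrderAt_mul hγan (analyticAt_dedekindZetaCont_half K), hγ0, zero_add]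

/-- **`ord_{s=1/2} ζ_K` is finite**: `ζ_K` is holomorphic on the connected open set `ℂ ∖ {1}` and
`ζ_K(2) ≠ 0` (`dedekindZetaCont_ne_zero_of_one_le_re_holds`), so it does not vanish identically
near `1/2` (identity theorem, Mathlib `AnalyticOnNhd.analyticOrderAt_ne_top_of_isPreconnected`).
[cite: NeukirchANT1999, Ch. VII (5.11) (i)] -/
theorem analyticOrderAt_dedekindZetaCont_half_ne_top :
    analyticOrderAt (dedekindZetaCont K) ((1 : ℂ) / 2) ≠ ⊤ := by
  have han : AnalyticOnNhd ℂ (dedekindZetaCont K) ({1}ᶜ : Set ℂ) :=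
    (differentiableOn_dedekindZetaCont_holds K).analyticOnNhd isOpen_compl_singleton
  have hpc : IsPreconnected (({1} : Set ℂ)ᶜ) :=
    (isConnected_compl_singleton_of_one_lt_rank (rank_real_complex ▸ Nat.one_lt_ofNat) _)
      |>.isPreconnected
  have h2 : analyticOrderAt (dedekindZetaCont K) 2 ≠ ⊤ := by
    rw [(han 2 (by norm_num)).analyticOrderAt_eq_zero.mpr
      (dedekindZetaCont_ne_zero_of_one_le_re_holds K (by norm_num) (by norm_num))]
    exact ENat.zero_ne_top
  exact han.analyticOrderAt_ne_top_of_isPreconnected hpc (by norm_num) (by norm_num) h2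

/-- **The order of vanishing of `ζ_K(s)` at `s = 1/2` is even**, for every number field `K`
(root number `+1` of `ζ_K`; so central zeros of Dedekind zeta functions — Armitage 1972,
Fröhlich 1972 — come with even multiplicity). [cite: NeukirchANT1999, VII (5.10) Corollary]
[cite: Frohlich1972, Introduction] -/
theorem even_analyticOrderNatAt_dedekindZetaCont_half :
    Even (analyticOrderNatAt (dedekindZetaCont K) ((1 : ℂ) / 2)) := by
  have h := even_analyticOrderNatAt_completedDedekindZeta_half K
  simp only [analyticOrderNatAt, analyticOrderAt_dedekindZetaCont_half_eq K] at h ⊢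
  exact h

/-- **A central zero of `ζ_K` is at least double**: if `ζ_K(1/2) = 0` then `ord_{s=1/2} ζ_K ≥ 2`
(the order is positive, finite and even). [cite: Frohlich1972, Introduction]
[cite: NeukirchANT1999, VII (5.10) Corollary] -/
theorem two_le_analyticOrderNatAt_dedekindZetaCont_half_of_eq_zero
    (h0 : dedekindZetaCont K ((1 : ℂ) / 2) = 0) :
    2 ≤ analyticOrderNatAt (dedekindZetaCont K) ((1 : ℂ) / 2) := by
  obtain ⟨k, hk⟩ := even_analyticOrderNatAt_dedekindZetaCont_half K
  have hne : analyticOrderNatAt (dedekindZetaCont K) ((1 : ℂ) / 2) ≠ 0 := by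
    intro h
    have h' : analyticOrderAt (dedekindZetaCont K) ((1 : ℂ) / 2) = 0 := by
      rw [← Nat.cast_analyticOrderNatAt (analyticOrderAt_dedekindZetaCont_half_ne_top K), h,
        Nat.cast_zero]
    exact ((analyticAt_dedekindZetaCont_half K).analyticOrderAt_eq_zero.mp h') h0
  omega

end DedekindZeta

end Literature.NumberTheory.LFunctions
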